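import Summits.CriticalPhenomena.PercolationContinuityZ3.Theorems.PercNearOneGluingNoHeavyLowerTailAntitheticFirmSliceLobes
import Summits.CriticalPhenomena.PercolationContinuityZ3.Theorems.PercNearOneGluingNoHeavyLowerTailAntitheticFirmFamily
import Summits.CriticalPhenomena.PercolationContinuityZ3.Theorems.PercNearOneGluingNoHeavyLowerTailAntitheticLatticePieces
import HarnessLib

/-!
# `NoHeavyLowerTail` (stmt-CriticalPhenomena-4575) — antithetic cluster pairs: THEOREM D⁺ (the FIRM slice is nonnegative)
# (prim-hp-2 gen 50, MEMO-gen50 §2 (L2⁺))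

Support file (`--supports stmt-CriticalPhenomena-4575`, hull-port prover `prim-hp-2`, gen 50).  No named facts, no sorries; standard axioms.  One
`def` (`Antithetic.Firm.fam`, the flip family as a Finset); the other bookkeeping `def`s live in `…AntitheticFirmSliceTools`.

Setting (MEMO-gen31/49/50): colouring `ω ⊆ Sym2 V` of `E`, source `s`; `W = red`, `W' = blue` vertex clusters of `s`; core `W ∩ W'`; `D(R)`:
no vertex of `R` in the core; `Δ_{F,G}(ω) = (F(W) − F(W'))(G(W) − G(W'))` for increasing vertex functions `F, G`.  A colouring is FIRM if it lies
in `D(R)` and its core is joined to `s` in red AND in blue by paths INSIDE the core (a core `{s}` is firm: THEOREM D's slice).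

**THEOREM D⁺** (`Antithetic.Firm.firm_slice_nonneg`): on every finite graph, for every source, forbidden set `R` and increasing `F, G`, the sum
of `Δ_{F,G}` over the firm colourings is `≥ 0`.  Proof (MEMO-gen50 §2): BLEACH a firm `ω` (flip every edge meeting a red-only vertex,
`…AntitheticAbstractCubes`); the result `x` is nested with red cluster = core, blue cluster = `W ∪ W'`; the firm slice is partitioned into the
FLIP FAMILIES `{x ∆ fl S : S a union of blue lobes of x}` (`Firm.fam`; self-consistency `Firm.member_facts`: members have the same core, are firm,
and bleach back to `x`); each family is nonnegative by the two canonical abstract cubes (`Antithetic.firm_family_sum_nonneg` of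
`…AntitheticFirmFamily`, `lobecube_sum_nonneg` of `…AntitheticLobeFlip`); the partition principle `sum_nonneg_of_parts` adds them up.
[cite: VandenbergHaggstromKahn2005, §1 p. 6 ("Harris' inequality")]
-/

noncomputable section

namespace Summit.CriticalPhenomena.PercolationContinuityZ3.Theorems

open Literature.Probability.Percolation
open scoped Classical symmDiff

namespace Antithetic

namespace Firm

variable {V : Type*}

section Assembly

variable [Fintype V] {E : Set (Sym2 V)} {s : V}

/-- the flip FAMILY of a colouring `x`: all `x ∆ fl S` with `S` a closed set of blue-only vertices. [this work] -/
def fam (E : Set (Sym2 V)) (s : V) (x : Set (Sym2 V)) : Finset (Set (Sym2 V)) :=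
  Finset.univ.filter fun M => ∃ S : Set V,
    (S ⊆ bo E s x ∧ ∀ a b, s(a, b) ∈ E → a ∈ S → b ∈ bo E s x → b ∈ S) ∧ M = x ∆ fl E S

/-- the flip family is the image of the power set of the blue lobes under `T ↦ x ∆ fl (⋃ T)`. [this work] -/
theorem fam_eq_image (x : Set (Sym2 V)) :
    fam E s x = Finset.univ.image fun T : Set {L : Set V // L ∈ Lobes E s x} => x ∆ fl E (⋃ L ∈ T, (L : Set V)) := by
  ext M
  simp only [fam, Finset.mem_filter, Finset.mem_univ, true_and, Finset.mem_image]
  constructor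
  · rintro ⟨S, ⟨hS, hcl⟩, rfl⟩
    refine ⟨{L | (L : Set V) ⊆ S}, ?_⟩
    rw [← closed_eq_union x hS hcl]
  · rintro ⟨T, rfl⟩
    exact ⟨_, union_lobes_closed x T, rfl⟩

/-- **The flip family of a firm nested colouring has nonnegative antithetic sum.** [this work] -/
theorem fam_sum_nonneg (x : Set (Sym2 V)) (hnest : red E s x ⊆ blue E s x)
    (hfirm : red E s x ⊆ blue E s (x ∆ fl E (bo E s x)))
    {F G : Set V → ℝ} (hF : Monotone F) (hG : Monotone G) :
    0 ≤ ∑ M ∈ fam E s x, (F (red E s M) - F (blue E s M)) * (G (red E s M) - G (blue E s M)) := by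
  rw [fam_eq_image, Finset.sum_image fun T _ T' _ h => flip_injective x h]
  set ι := {L : Set V // L ∈ Lobes E s x}
  -- hypotheses of the firm family theorem for the lobe system
  have hMU : ∀ L : ι, (L : Set V) ⊆ openCluster (xᶜ ∩ E) s := fun L => by
    obtain ⟨v, hv, hL⟩ := L.2; intro w hw
    have : w ∈ lobe E s x v := by rw [← hL]; exact hw
    exact (lobe_subset_bo hv this).1
  have hMJ : ∀ L : ι, Disjoint (L : Set V) (openCluster (x ∩ E) s) := fun L => by
    obtain ⟨v, hv, hL⟩ := L.2
    exact Set.disjoint_left.2 fun w hw hwJ => by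
      have : w ∈ lobe E s x v := by rw [← hL]; exact hw
      exact (lobe_subset_bo hv this).2 hwJ
  have hcl : ∀ (L : ι) a b, s(a, b) ∈ E → a ∈ (L : Set V) → b ∈ openCluster (xᶜ ∩ E) s →
      b ∉ openCluster (x ∩ E) s → b ∈ (L : Set V) := fun L a b hE ha hbU hbJ => by
    obtain ⟨v, hv, hL⟩ := L.2
    have ha' : a ∈ lobe E s x v := by rw [← hL]; exact ha
    have := lobe_closed hv hE ha' ⟨hbU, hbJ⟩
    rw [hL]; exact this
  have hcov : openCluster (xᶜ ∩ E) s \ openCluster (x ∩ E) s ⊆ ⋃ L : ι, (L : Set V) := fun v hv =>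
    Set.mem_iUnion.2 ⟨⟨lobe E s x v, v, hv, rfl⟩, mem_lobe_self v⟩
  have hdisj : ∀ L L' : ι, L ≠ L' → Disjoint (L : Set V) (L' : Set V) := fun L L' hne =>
    Set.disjoint_left.2 fun w hw hw' => hne (by
      obtain ⟨v, hv, hL⟩ := L.2; obtain ⟨v', hv', hL'⟩ := L'.2
      apply Subtype.ext
      have h1 : w ∈ lobe E s x v := by rw [← hL]; exact hw
      have h2 : w ∈ lobe E s x v' := by rw [← hL']; exact hw'
      rw [hL, hL', ← lobe_eq_of_mem h1, ← lobe_eq_of_mem h2])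
  -- the all-lobes flip set equals the flip set of the whole blue-only region
  have hall : (⋃ L : ι, (L : Set V)) = bo E s x := by
    apply Set.Subset.antisymm
    · intro w hw; obtain ⟨L, hwL⟩ := Set.mem_iUnion.1 hw; exact (union_lobes_closed x {L}).1 (Set.mem_iUnion₂.2 ⟨L, rfl, hwL⟩)
    · exact hcov
  have hfirm' : openCluster (x ∩ E) s ⊆ openCluster ((x ∆ {e | e ∈ E ∧ ∃ v ∈ e, v ∈ ⋃ L : ι, (L : Set V)})ᶜ ∩ E) s := by
    rw [hall]; exact hfirm
  rcases isEmpty_or_nonempty ι with hι | ⟨⟨i₀⟩⟩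
  · -- no lobes: every term is Δ(x) with nested clusters, hence ≥ 0
    refine Finset.sum_nonneg fun T _ => ?_
    have hT : (⋃ L ∈ T, (L : Set V)) = ∅ := by
      ext w; simp only [Set.mem_iUnion, Set.mem_empty_iff_false, iff_false]; rintro ⟨L, -, -⟩; exact hι.elim L
    have hfl0 : fl E (∅ : Set V) = ∅ := by ext e; simp [fl]
    have hx0 : x ∆ (∅ : Set (Sym2 V)) = x := by
      rw [Set.symmDiff_def, Set.sdiff_empty, Set.empty_sdiff, Set.union_empty]
    rw [hT, hfl0, hx0]
    have h1 : F (red E s x) - F (blue E s x) ≤ 0 := sub_nonpos.2 (hF hnest)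
    have h2 : G (red E s x) - G (blue E s x) ≤ 0 := sub_nonpos.2 (hG hnest)
    nlinarith
  · have h := firm_family_sum_nonneg E x s (fun L : ι => (L : Set V)) i₀ hMU hMJ hcl hcov hdisj hfirm' hF hG
    exact h

/-- **THEOREM D⁺ (prim-hp-2 gen 50): the FIRM slice of the antithetic sum is nonnegative on every finite graph (vertex version).**  For every edge
set `E` on a finite vertex type, source `s`, forbidden set `R` and increasing vertex functions `F, G`:
`0 ≤ Σ_{ω : no r ∈ R in both clusters, core joined to s in red AND in blue inside the core} (F(W) − F(W')) · (G(W) − G(W'))`.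
The slice contains THEOREM D's slice `W ∩ W' = {s}` (a one-point core is trivially bi-connected); the first new configurations have cores
carrying two edge-disjoint monochromatic spanning trees (e.g. `K₄` cores in `K₅`).  Proof: the slice is partitioned into the flip families of the
bleached colourings (`Firm.fam (Firm.bleach ω)`), each nonnegative by the two canonical abstract cubes (`Firm.fam_sum_nonneg`,
`firm_family_sum_nonneg`, `lobecube_sum_nonneg`) — MEMO-gen50 §2 (L2⁺). [this work] -/
theorem firm_slice_nonneg (E : Set (Sym2 V)) (s : V) (R : Set V) {F G : Set V → ℝ} (hF : Monotone F) (hG : Monotone G) :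
    0 ≤ ∑ ω ∈ Finset.univ.filter (fun ω : Set (Sym2 V) =>
        (∀ r ∈ R, ¬ (r ∈ red E s ω ∧ r ∈ blue E s ω)) ∧
        (∀ v, v ∈ red E s ω → v ∈ blue E s ω → (openGraph (ω ∩ E ∩ inside (red E s ω ∩ blue E s ω))).Reachable s v) ∧
        (∀ v, v ∈ red E s ω → v ∈ blue E s ω → (openGraph (ωᶜ ∩ E ∩ inside (red E s ω ∩ blue E s ω))).Reachable s v)),
      (F (red E s ω) - F (blue E s ω)) * (G (red E s ω) - G (blue E s ω)) := by
  refine sum_nonneg_of_parts _ _ (fun ω => fam E s (bleach E s ω)) ?_ ?_ ?_ ?_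
  · -- every firm ω lies in the family of its bleaching
    intro ω hω
    rw [Finset.mem_filter] at hω
    simp only [fam, Finset.mem_filter, Finset.mem_univ, true_and]
    exact ⟨_, redonly_closed hω.2.2.1, mem_family_self ω⟩
  · -- family members are firm
    intro ω hω M hM
    rw [Finset.mem_filter] at hω
    obtain ⟨hD, hr, hb⟩ := hω.2
    simp only [fam, Finset.mem_filter, Finset.mem_univ, true_and] at hM
    obtain ⟨S, ⟨hS, hcl⟩, rfl⟩ := hM
    obtain ⟨h1, h2, h3, h4, h5, h6, h7, h8⟩ := member_facts hr hb hS hcl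
    rw [Finset.mem_filter]
    refine ⟨Finset.mem_univ _, ?_, ?_, ?_⟩
    · intro r hrR hboth
      exact hD r hrR (by rw [← Set.mem_inter_iff, ← h4]; exact hboth)
    · intro v hvr hvb
      have hv : v ∈ red E s ω ∩ blue E s ω := by rw [← h4]; exact ⟨hvr, hvb⟩
      have := hr v hv.1 hv.2
      rw [h4]
      show (openGraph ((bleach E s ω ∆ fl E S) ∩ E ∩ inside (red E s ω ∩ blue E s ω))).Reachable s v
      rw [h5]; exact this
    · intro v hvr hvb
      have hv : v ∈ red E s ω ∩ blue E s ω := by rw [← h4]; exact ⟨hvr, hvb⟩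
      have := hb v hv.1 hv.2
      rw [h4]
      show (openGraph ((bleach E s ω ∆ fl E S)ᶜ ∩ E ∩ inside (red E s ω ∩ blue E s ω))).Reachable s v
      rw [h6]; exact this
  · -- the part is constant on itself
    intro ω hω M hM
    rw [Finset.mem_filter] at hω
    obtain ⟨hD, hr, hb⟩ := hω.2
    simp only [fam, Finset.mem_filter, Finset.mem_univ, true_and] at hM
    obtain ⟨S, ⟨hS, hcl⟩, rfl⟩ := hM
    obtain ⟨h1, h2, h3, h4, h5, h6, h7, h8⟩ := member_facts hr hb hS hcl
    show fam E s (bleach E s (bleach E s ω ∆ fl E S)) = fam E s (bleach E s ω)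
    rw [h8]
  · -- each family is nonnegative
    intro ω hω
    rw [Finset.mem_filter] at hω
    obtain ⟨hD, hr, hb⟩ := hω.2
    have hnest : red E s (bleach E s ω) ⊆ blue E s (bleach E s ω) := by
      rw [bleach_red_eq hr, bleach_blue_eq]; exact fun v hv => Or.inl hv.1
    -- firmness of the bleached colouring: flipping the whole blue-only region keeps the core blue
    have hS := union_lobes_closed (E := E) (s := s) (bleach E s ω) Set.univ
    have hbo : (⋃ L ∈ (Set.univ : Set {L : Set V // L ∈ Lobes E s (bleach E s ω)}), (L : Set V)) = bo E s (bleach E s ω) := by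
      apply Set.Subset.antisymm hS.1
      intro v hv
      exact Set.mem_iUnion₂.2 ⟨⟨lobe E s _ v, v, hv, rfl⟩, Set.mem_univ _, mem_lobe_self v⟩
    have hfm := member_facts hr hb hS.1 hS.2
    have hfirm : red E s (bleach E s ω) ⊆ blue E s (bleach E s ω ∆ fl E (bo E s (bleach E s ω))) := by
      rw [bleach_red_eq hr, ← hbo]; exact hfm.2.1
    exact fam_sum_nonneg (bleach E s ω) hnest hfirm hF hG

end Assembly

end Firm

end Antithetic

end Summit.CriticalPhenomena.PercolationContinuityZ3.Theorems
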